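import Literature.NumberTheory.GaloisRepresentations.HasseArfQuadraticExt
import HarnessLib

/-!
# Hasse–Arf: enlarging the residue field by an unramified quadratic base change (arithmetic part)

Setting of `HasseArfCyclic`/`hasseArf_of_cyclic`: `R` Dedekind with fraction field `K`, `L/K`
finite Galois with group `G`, `S = integralClosure R L`, `𝔓 ≠ 0` a maximal ideal of `S` at which
`L/K` is totally ramified (`𝔓.inertia G = ⊤`), with separable residue extension.  Serre's proof
of Prop. V.11 (`card_dvd_ramificationCardSum_of_exists_sub_natCast_notMem`) needs the residue
field of `𝔓` not to be the prime field.  When it is (the only case where some hypothesis is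
needed), we pass to `L_f = L[X]/(f)` for a monic quadratic `f = X² - tX + n ∈ R[X]` without roots
modulo `𝔓` and with unit discriminant `d = t² - 4n` (an *unramified* quadratic base change,
Serre V §4 Lemma 7): with `K_f = K(α)`, `R_f = integralClosure R K_f`, `S_f = integralClosure R_f L_f`
and `𝔓_f = 𝔓 S_f` we prove that `𝔓_f` is a maximal ideal (`S_f/𝔓_f ≅ κ[X]/(f̄)`, a field with more
than `p` elements), that `L_f/K_f` is again totally ramified at `𝔓_f` with the *same* ramification
groups (`|(G_f)_i| = |G_i|` under the restriction isomorphism `G_f ≃ G` of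
`HasseArfQuadraticExt`), and deduce Prop. V.11 for `(L, 𝔓)` from Prop. V.11 for `(L_f, 𝔓_f)`:
`card_dvd_sum_card_ramificationSubgroup_of_forall_exists_sub_natCast_mem`.

## References

* J.-P. Serre, *Local Fields*, GTM 67, Springer 1979: Ch. V §4 Lemma 7, §7 p. 94; Ch. I §6
  Prop. 15–17 (unramified extensions), Ch. III §5 (`d 𝒪 ⊆ 𝒪[α]`). [SerreLocalFields1979]
-/

open Polynomial
open scoped Pointwise

noncomputable section

namespace Literature.NumberTheory.GaloisRepresentations

section ResidueExt

variable {R : Type*} (K L : Type*) [CommRing R] [Field K] [Field L] [Algebra R K] [Algebra R L]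
  [Algebra K L] [IsScalarTower R K L] (t n : R)
  [Fact (Irreducible (((quadPoly t n).map (algebraMap R K)).map (algebraMap K L)))]

local notation "fKL" => Polynomial.map (algebraMap K L) (Polynomial.map (algebraMap R K) (quadPoly t n))
local notation "Ef" => AdjoinRoot fKL
local notation "Kf" => IntermediateField.adjoin K ({AdjoinRoot.root fKL} : Set (AdjoinRoot fKL))
local notation "Sf" => integralClosure R Ef
local notation "SL" => integralClosure R L

/-- **The inclusion `ι : S_L → S_f`** (`x ↦ x` along `L ⊆ L_f`). [folklore] -/
def inclSf : SL →+* Sf where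
  toFun x := ⟨algebraMap L Ef x, (mem_integralClosure_iff R Ef).mpr (x.2.map (IsScalarTower.toAlgHom R L Ef))⟩
  map_one' := Subtype.ext (by simp)
  map_mul' x y := Subtype.ext (by simp)
  map_zero' := Subtype.ext (by simp)
  map_add' x y := Subtype.ext (by simp)

omit [IsScalarTower R K L] in
/-- `ι x = x` in `L_f`. [folklore] -/
theorem coe_inclSf (x : SL) : ((inclSf K L t n x : Sf) : Ef) = algebraMap L Ef x := rfl

omit [IsScalarTower R K L] in
/-- `ι` is injective. [folklore] -/
theorem inclSf_injective : Function.Injective (inclSf K L t n) := fun x y h => by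
  have h' := congrArg (fun z : Sf => (z : Ef)) h
  simp only [coe_inclSf] at h'
  exact Subtype.ext ((algebraMap L Ef).injective h')

/-- `α ∈ S_f`. [folklore] -/
theorem root_mem_integralClosure_adjoinRoot : AdjoinRoot.root fKL ∈ Sf :=
  (mem_integralClosure_iff R Ef).mpr (isIntegral_root K L t n)

/-- **`d y ∈ S_L + S_L α` for `y ∈ S_f`**, `d = t² - 4n`: the `d`-scaled coordinates of an
integral element are in `S_L` (`isIntegral_coord`); here `S_f = integralClosure R L_f`. [folklore] -/
theorem exists_mul_eq_incl_add_incl_mul_root (y : Sf) :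
    ∃ a b : SL, (a : L) = (coord K L t n (y : Ef)).1 * algebraMap R L (t ^ 2 - 4 * n) ∧
      (b : L) = (coord K L t n (y : Ef)).2 * algebraMap R L (t ^ 2 - 4 * n) ∧
      algebraMap R Sf (t ^ 2 - 4 * n) * y =
        inclSf K L t n a + inclSf K L t n b * ⟨AdjoinRoot.root fKL, root_mem_integralClosure_adjoinRoot K L t n⟩ := by
  obtain ⟨ha, hb⟩ := isIntegral_coord K L t n (y : Ef) ((mem_integralClosure_iff R Ef).mp y.2)
  refine ⟨⟨_, ha⟩, ⟨_, hb⟩, rfl, rfl, Subtype.ext ?_⟩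
  simp only [Subalgebra.coe_mul, Subalgebra.coe_add, coe_inclSf, Subalgebra.coe_algebraMap]
  rw [map_mul, map_mul, ← IsScalarTower.algebraMap_apply R L Ef]
  conv_lhs => rw [coord_spec K L t n (y : Ef)]
  ring

/-- The `S_L`-coordinate `a d` of `d y`, `y ∈ S_f`. [folklore] -/
def cA (y : Sf) : SL := Classical.choose (exists_mul_eq_incl_add_incl_mul_root K L t n y)

/-- The `S_L`-coordinate `b d` of `d y`, `y ∈ S_f`. [folklore] -/
def cB (y : Sf) : SL := Classical.choose (Classical.choose_spec (exists_mul_eq_incl_add_incl_mul_root K L t n y))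

/-- `cA y = a d` in `L`. [folklore] -/
theorem coe_cA (y : Sf) : (cA K L t n y : L) = (coord K L t n (y : Ef)).1 * algebraMap R L (t ^ 2 - 4 * n) :=
  (Classical.choose_spec (Classical.choose_spec (exists_mul_eq_incl_add_incl_mul_root K L t n y))).1

/-- `cB y = b d` in `L`. [folklore] -/
theorem coe_cB (y : Sf) : (cB K L t n y : L) = (coord K L t n (y : Ef)).2 * algebraMap R L (t ^ 2 - 4 * n) :=
  (Classical.choose_spec (Classical.choose_spec (exists_mul_eq_incl_add_incl_mul_root K L t n y))).2.1

/-- `d y = ι(cA y) + ι(cB y) α`. [folklore] -/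
theorem algebraMap_mul_eq_cA_cB (y : Sf) : algebraMap R Sf (t ^ 2 - 4 * n) * y =
    inclSf K L t n (cA K L t n y) + inclSf K L t n (cB K L t n y) *
      ⟨AdjoinRoot.root fKL, root_mem_integralClosure_adjoinRoot K L t n⟩ :=
  (Classical.choose_spec (Classical.choose_spec (exists_mul_eq_incl_add_incl_mul_root K L t n y))).2.2

/-- Coordinates of a sum. [folklore] -/
theorem cA_add (y₁ y₂ : Sf) : cA K L t n (y₁ + y₂) = cA K L t n y₁ + cA K L t n y₂ ∧
    cB K L t n (y₁ + y₂) = cB K L t n y₁ + cB K L t n y₂ := by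
  constructor <;> apply Subtype.ext
  · rw [Subalgebra.coe_add, coe_cA, coe_cA, coe_cA, Subalgebra.coe_add, coord_add]; ring
  · rw [Subalgebra.coe_add, coe_cB, coe_cB, coe_cB, Subalgebra.coe_add, coord_add]; ring

/-- Coordinates of a product (scaled by `d`). [folklore] -/
theorem cA_mul (y₁ y₂ : Sf) :
    algebraMap R SL (t ^ 2 - 4 * n) * cA K L t n (y₁ * y₂) =
      cA K L t n y₁ * cA K L t n y₂ - algebraMap R SL n * (cB K L t n y₁ * cB K L t n y₂) ∧
    algebraMap R SL (t ^ 2 - 4 * n) * cB K L t n (y₁ * y₂) =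
      cA K L t n y₁ * cB K L t n y₂ + cA K L t n y₂ * cB K L t n y₁ +
        algebraMap R SL t * (cB K L t n y₁ * cB K L t n y₂) := by
  constructor <;> apply Subtype.ext
  · simp only [Subalgebra.coe_mul, Subalgebra.coe_sub, Subalgebra.coe_algebraMap, coe_cA, coe_cB,
      coord_mul]
    ring
  · simp only [Subalgebra.coe_mul, Subalgebra.coe_add, Subalgebra.coe_algebraMap, coe_cA, coe_cB,
      coord_mul]
    ring

/-- Coordinates of `1`. [folklore] -/
theorem cA_one : cA K L t n 1 = algebraMap R SL (t ^ 2 - 4 * n) ∧ cB K L t n 1 = 0 := by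
  have h1 : coord K L t n ((1 : Sf) : Ef) = (1, 0) := by
    rw [OneMemClass.coe_one, ← map_one (algebraMap L Ef), coord_algebraMap]
  constructor <;> apply Subtype.ext
  · rw [coe_cA, h1, Subalgebra.coe_algebraMap]; simp
  · rw [coe_cB, h1]; simp

/-- Coordinates of `ι x`. [folklore] -/
theorem cA_inclSf (x : SL) : cA K L t n (inclSf K L t n x) = x * algebraMap R SL (t ^ 2 - 4 * n) ∧
    cB K L t n (inclSf K L t n x) = 0 := by
  have h1 : coord K L t n ((inclSf K L t n x : Sf) : Ef) = ((x : L), 0) := by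
    rw [coe_inclSf, coord_algebraMap]
  constructor <;> apply Subtype.ext
  · rw [coe_cA, h1, Subalgebra.coe_mul, Subalgebra.coe_algebraMap]
  · rw [coe_cB, h1]; simp

/-- Coordinates of `α`. [folklore] -/
theorem cA_root : cA K L t n ⟨AdjoinRoot.root fKL, root_mem_integralClosure_adjoinRoot K L t n⟩ = 0 ∧
    cB K L t n ⟨AdjoinRoot.root fKL, root_mem_integralClosure_adjoinRoot K L t n⟩ =
      algebraMap R SL (t ^ 2 - 4 * n) := by
  have h1 : coord K L t n ((⟨AdjoinRoot.root fKL, root_mem_integralClosure_adjoinRoot K L t n⟩ : Sf) : Ef) =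
      (0, 1) := coord_root K L t n
  constructor <;> apply Subtype.ext
  · rw [coe_cA, h1]; simp
  · rw [coe_cB, h1, Subalgebra.coe_algebraMap]; simp

omit [IsScalarTower R K L] in
/-- `algebraMap R S_f d = ι (algebraMap R S_L d)`. [folklore] -/
theorem algebraMap_Sf_eq_inclSf (r : R) : algebraMap R Sf r = inclSf K L t n (algebraMap R SL r) :=
  Subtype.ext (by
    rw [Subalgebra.coe_algebraMap, coe_inclSf, Subalgebra.coe_algebraMap, ← IsScalarTower.algebraMap_apply])

set_option maxHeartbeats 3200000 in
set_option synthInstance.maxHeartbeats 400000 in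
/-- **The prime `𝔓_f = 𝔓 S_f` of the unramified quadratic base change.**  Let `𝔓` be a maximal
ideal of `S_L`, `f = X² - tX + n ∈ R[X]` without roots modulo `𝔓` and with discriminant
`d = t² - 4n ∉ 𝔓`.  Then the reduction map `S_f → κ[X]/(f̄)`, `y ↦ d₁(ā + b̄ X)` (`d y = a + bα`,
`d d₁ ≡ 1`), is a surjective ring homomorphism with kernel `𝔓 S_f`; hence `𝔓 S_f` is a maximal
ideal with `𝔓 S_f ∩ S_L = 𝔓`, residue field `κ(ᾱ) ⊋ κ` (the class of `α` is not the class of a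
natural number), finite if `κ` is.  Ref: Serre, *Local Fields*, Ch. I §6 Prop. 15 (unramified
extensions `A[X]/(f)`, `f̄` irreducible separable). [cite: SerreLocalFields1979, Ch. I §6 Prop. 15] -/
theorem map_inclSf_spec (𝔓 : Ideal SL) [h𝔓max : 𝔓.IsMaximal]
    (hnoroot : ∀ s : SL, s * s - algebraMap R SL t * s + algebraMap R SL n ∉ 𝔓)
    (hd : algebraMap R SL (t ^ 2 - 4 * n) ∉ 𝔓) :
    (𝔓.map (inclSf K L t n)).IsMaximal ∧ (𝔓.map (inclSf K L t n)).comap (inclSf K L t n) = 𝔓 ∧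
    (Finite (SL ⧸ 𝔓) → Finite (Sf ⧸ 𝔓.map (inclSf K L t n))) ∧
    ∀ m : ℕ, (⟨AdjoinRoot.root fKL, root_mem_integralClosure_adjoinRoot K L t n⟩ : Sf) - m ∉
      𝔓.map (inclSf K L t n) := by
  classical
  letI : Field (SL ⧸ 𝔓) := Ideal.Quotient.field 𝔓
  set π := Ideal.Quotient.mk 𝔓 with hπ
  set ι := inclSf K L t n with hι
  set d' : SL := algebraMap R SL (t ^ 2 - 4 * n) with hd'
  set t' : SL := algebraMap R SL t with ht'
  set n' : SL := algebraMap R SL n with hn'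
  set αS : Sf := ⟨AdjoinRoot.root fKL, root_mem_integralClosure_adjoinRoot K L t n⟩ with hαS
  have hdι : algebraMap R Sf (t ^ 2 - 4 * n) = ι d' := algebraMap_Sf_eq_inclSf K L t n _
  obtain ⟨d₁, i₀, hi₀, hd₁⟩ := Ideal.IsMaximal.exists_inv h𝔓max hd
  have hπi₀ : π i₀ = 0 := Ideal.Quotient.eq_zero_iff_mem.mpr hi₀
  have hπd : π d₁ * π d' = 1 := by
    rw [← map_mul, ← map_one π, ← hd₁, map_add, hπi₀, add_zero]
  have hd₁P : d₁ ∉ 𝔓 := fun h => by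
    have : π d₁ = 0 := Ideal.Quotient.eq_zero_iff_mem.mpr h
    rw [this, zero_mul] at hπd; exact zero_ne_one hπd
  -- `f̄` and the field `F = κ[X]/(f̄)`
  set fbar : (SL ⧸ 𝔓)[X] := quadPoly (π t') (π n') with hfbar
  have hfm : fbar.Monic ∧ fbar.natDegree = 2 := ⟨monic_quadPoly _ _, natDegree_quadPoly _ _⟩
  have hfbar_irr : Irreducible fbar := by
    refine (Polynomial.Monic.irreducible_iff_roots_eq_zero_of_degree_le_three hfm.1
      (by rw [hfm.2]) (by rw [hfm.2]; norm_num)).mpr ?_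
    refine Multiset.eq_zero_of_forall_notMem fun r hr => ?_
    rw [Polynomial.mem_roots hfm.1.ne_zero] at hr
    obtain ⟨s, rfl⟩ := Ideal.Quotient.mk_surjective r
    apply hnoroot s
    rw [← Ideal.Quotient.eq_zero_iff_mem, ← hπ]
    have h : Polynomial.eval (π s) (X ^ 2 - C (π t') * X + C (π n')) = 0 := hr
    rw [Polynomial.eval_add, Polynomial.eval_sub, Polynomial.eval_mul, Polynomial.eval_pow,
      Polynomial.eval_C, Polynomial.eval_C, Polynomial.eval_X] at h
    rw [map_add, map_sub, map_mul, map_mul, ← h]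
    ring
  haveI : Fact (Irreducible fbar) := ⟨hfbar_irr⟩
  -- the reduction map `Φ`
  have hXsq : AdjoinRoot.root fbar ^ 2 = AdjoinRoot.of fbar (π t') * AdjoinRoot.root fbar -
      AdjoinRoot.of fbar (π n') := by
    have h : Polynomial.eval₂ (AdjoinRoot.of fbar) (AdjoinRoot.root fbar)
        (X ^ 2 - C (π t') * X + C (π n')) = 0 := AdjoinRoot.eval₂_root fbar
    rw [Polynomial.eval₂_add, Polynomial.eval₂_sub, Polynomial.eval₂_mul,
      Polynomial.eval₂_X_pow, Polynomial.eval₂_C, Polynomial.eval₂_C, Polynomial.eval₂_X] at h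
    linear_combination h
  set Φf : Sf → AdjoinRoot fbar := fun y =>
    AdjoinRoot.of fbar (π (d₁ * cA K L t n y)) + AdjoinRoot.of fbar (π (d₁ * cB K L t n y)) * AdjoinRoot.root fbar
    with hΦf
  have hΦf_apply : ∀ y, Φf y = AdjoinRoot.of fbar (π (d₁ * cA K L t n y)) +
      AdjoinRoot.of fbar (π (d₁ * cB K L t n y)) * AdjoinRoot.root fbar := fun y => rfl
  have hone : Φf 1 = 1 := by
    rw [hΦf_apply, (cA_one K L t n).1, (cA_one K L t n).2, mul_zero, map_zero, map_zero, zero_mul,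
      add_zero, ← hd', map_mul π d₁ d', hπd, map_one]
  have hadd : ∀ y₁ y₂, Φf (y₁ + y₂) = Φf y₁ + Φf y₂ := fun y₁ y₂ => by
    simp only [hΦf_apply, (cA_add K L t n y₁ y₂).1, (cA_add K L t n y₁ y₂).2, mul_add, map_add]
    ring
  have hmul : ∀ y₁ y₂, Φf (y₁ * y₂) = Φf y₁ * Φf y₂ := fun y₁ y₂ => by
    obtain ⟨hA, hB⟩ := cA_mul K L t n y₁ y₂
    rw [← hd', ← hn'] at hA
    rw [← hd', ← ht'] at hB
    -- multiply the coordinates of the product by `π(d₁ d') = 1`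
    have kA : π (d₁ * cA K L t n (y₁ * y₂)) = π (d₁ * cA K L t n y₁) * π (d₁ * cA K L t n y₂) -
        π n' * (π (d₁ * cB K L t n y₁) * π (d₁ * cB K L t n y₂)) := by
      have : π (d₁ * cA K L t n (y₁ * y₂)) = π d₁ * (π d₁ * π d') * π (cA K L t n (y₁ * y₂)) := by
        rw [hπd, mul_one, map_mul]
      rw [this, show π d₁ * (π d₁ * π d') * π (cA K L t n (y₁ * y₂)) =
        π d₁ * π d₁ * π (d' * cA K L t n (y₁ * y₂)) by rw [map_mul]; ring, hA]
      simp only [map_sub, map_mul]; ring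
    have kB : π (d₁ * cB K L t n (y₁ * y₂)) = π (d₁ * cA K L t n y₁) * π (d₁ * cB K L t n y₂) +
        π (d₁ * cA K L t n y₂) * π (d₁ * cB K L t n y₁) +
        π t' * (π (d₁ * cB K L t n y₁) * π (d₁ * cB K L t n y₂)) := by
      have : π (d₁ * cB K L t n (y₁ * y₂)) = π d₁ * (π d₁ * π d') * π (cB K L t n (y₁ * y₂)) := by
        rw [hπd, mul_one, map_mul]
      rw [this, show π d₁ * (π d₁ * π d') * π (cB K L t n (y₁ * y₂)) =
        π d₁ * π d₁ * π (d' * cB K L t n (y₁ * y₂)) by rw [map_mul]; ring, hB]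
      simp only [map_add, map_mul]; ring
    rw [hΦf_apply, hΦf_apply, hΦf_apply, kA, kB]
    simp only [map_sub, map_add, map_mul]
    linear_combination (-((AdjoinRoot.of fbar (π d₁) * AdjoinRoot.of fbar (π (cB K L t n y₁))) *
      (AdjoinRoot.of fbar (π d₁) * AdjoinRoot.of fbar (π (cB K L t n y₂))))) * hXsq
  let Φ : Sf →+* AdjoinRoot fbar :=
    { toFun := Φf
      map_one' := hone
      map_mul' := hmul
      map_zero' := by
        have h := hadd 0 0
        rw [add_zero] at h
        have h' : Φf 0 + 0 = Φf 0 + Φf 0 := by rw [add_zero]; exact h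
        exact (add_left_cancel h').symm
      map_add' := hadd }
  have hΦ : ∀ y, Φ y = Φf y := fun y => rfl
  have hΦι : ∀ x : SL, Φ (ι x) = AdjoinRoot.of fbar (π x) := fun x => by
    rw [hΦ, hΦf_apply, (cA_inclSf K L t n x).1, (cA_inclSf K L t n x).2, ← hd', mul_zero, map_zero,
      map_zero, zero_mul, add_zero, show d₁ * (x * d') = (d₁ * d') * x by ring, map_mul π (d₁ * d') x,
      map_mul π d₁ d', hπd, one_mul]
  have hΦα : Φ αS = AdjoinRoot.root fbar := by
    rw [hΦ, hΦf_apply, (cA_root K L t n).1, (cA_root K L t n).2, ← hd', mul_zero, map_zero, map_zero,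
      zero_add, map_mul π d₁ d', hπd, map_one, one_mul]
  have hofinj : Function.Injective (AdjoinRoot.of fbar) := (AdjoinRoot.of fbar).injective
  -- surjectivity
  have hsurj : Function.Surjective Φ := by
    intro z
    obtain ⟨u, v, hz⟩ := AdjoinRoot.exists_eq_add_mul_root hfm.1 hfm.2 z
    obtain ⟨u', rfl⟩ := Ideal.Quotient.mk_surjective u
    obtain ⟨v', rfl⟩ := Ideal.Quotient.mk_surjective v
    refine ⟨ι u' + ι v' * αS, ?_⟩
    rw [map_add, map_mul, hΦι, hΦι, hΦα, hz, AdjoinRoot.algebraMap_eq]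
  -- kernel
  have hdeg2 : fbar.degree = 2 := by
    rw [Polynomial.degree_eq_natDegree hfm.1.ne_zero, hfm.2]; rfl
  have hker : RingHom.ker Φ = 𝔓.map ι := by
    apply le_antisymm
    · intro y hy
      rw [RingHom.mem_ker, hΦ, hΦf_apply] at hy
      -- both reduced coordinates vanish
      have hpoly : C (π (d₁ * cA K L t n y)) + C (π (d₁ * cB K L t n y)) * X = 0 := by
        have hmk : AdjoinRoot.mk fbar (C (π (d₁ * cA K L t n y)) + C (π (d₁ * cB K L t n y)) * X) = 0 := by
          rw [map_add (AdjoinRoot.mk fbar), map_mul (AdjoinRoot.mk fbar), AdjoinRoot.mk_C, AdjoinRoot.mk_C,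
            AdjoinRoot.mk_X]
          exact hy
        refine Polynomial.eq_zero_of_dvd_of_degree_lt (AdjoinRoot.mk_eq_zero.mp hmk) ?_
        rw [hdeg2]
        refine (Polynomial.degree_add_le _ _).trans_lt (max_lt ?_ ?_)
        · exact Polynomial.degree_C_le.trans_lt (by exact_mod_cast (show (0 : ℕ) < 2 by norm_num))
        · exact (Polynomial.degree_C_mul_X_le _).trans_lt (by exact_mod_cast (show (1 : ℕ) < 2 by norm_num))
      have hcoef0 : π (d₁ * cA K L t n y) = 0 := by
        have := congrArg (fun q : (SL ⧸ 𝔓)[X] => q.coeff 0) hpoly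
        simpa using this
      have hcoef1 : π (d₁ * cB K L t n y) = 0 := by
        have := congrArg (fun q : (SL ⧸ 𝔓)[X] => q.coeff 1) hpoly
        simpa using this
      have hA : cA K L t n y ∈ 𝔓 :=
        ((Ideal.IsMaximal.isPrime h𝔓max).mem_or_mem (Ideal.Quotient.eq_zero_iff_mem.mp hcoef0)).resolve_left hd₁P
      have hB : cB K L t n y ∈ 𝔓 :=
        ((Ideal.IsMaximal.isPrime h𝔓max).mem_or_mem (Ideal.Quotient.eq_zero_iff_mem.mp hcoef1)).resolve_left hd₁P
      have hdy : ι d' * y ∈ 𝔓.map ι := by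
        rw [← hdι, algebraMap_mul_eq_cA_cB]
        exact Ideal.add_mem _ (Ideal.mem_map_of_mem _ hA)
          (Ideal.mul_mem_right _ _ (Ideal.mem_map_of_mem _ hB))
      have hy' : y = ι d₁ * (ι d' * y) + ι i₀ * y := by
        rw [← mul_assoc, ← map_mul, ← add_mul, ← map_add, hd₁, map_one, one_mul]
      rw [hy']
      exact Ideal.add_mem _ (Ideal.mul_mem_left _ _ hdy) (Ideal.mul_mem_right _ _ (Ideal.mem_map_of_mem _ hi₀))
    · rw [Ideal.map_le_iff_le_comap]
      intro q hq
      rw [Ideal.mem_comap, RingHom.mem_ker, hΦι, Ideal.Quotient.eq_zero_iff_mem.mpr hq, map_zero]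
  ------------------------------------------------------------------
  -- conclusions
  ------------------------------------------------------------------
  have hmax : (𝔓.map ι).IsMaximal := hker ▸ RingHom.ker_isMaximal_of_surjective Φ hsurj
  refine ⟨hmax, ?_, ?_, ?_⟩
  · ext x
    rw [Ideal.mem_comap, ← hker, RingHom.mem_ker, hΦι, map_eq_zero_iff _ hofinj,
      Ideal.Quotient.eq_zero_iff_mem]
  · intro hfin
    haveI : Finite (SL ⧸ 𝔓) := hfin
    haveI : Module.Finite (SL ⧸ 𝔓) (AdjoinRoot fbar) := (AdjoinRoot.powerBasis hfm.1.ne_zero).finite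
    haveI : Finite (AdjoinRoot fbar) := Module.finite_of_finite (SL ⧸ 𝔓)
    rw [← hker]
    exact Finite.of_equiv _ (RingHom.quotientKerEquivOfSurjective hsurj).symm.toEquiv
  · intro m hm
    rw [← hker, RingHom.mem_ker, map_sub, map_natCast, hΦα] at hm
    have h1 : AdjoinRoot.mk fbar (X - C (m : SL ⧸ 𝔓)) = 0 := by
      rw [map_sub (AdjoinRoot.mk fbar), AdjoinRoot.mk_X, AdjoinRoot.mk_C, map_natCast]
      exact hm
    have h2 := Polynomial.eq_zero_of_dvd_of_degree_lt (AdjoinRoot.mk_eq_zero.mp h1) (by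
      rw [Polynomial.degree_X_sub_C, hdeg2]
      exact_mod_cast (show (1 : ℕ) < 2 by norm_num))
    exact Polynomial.X_sub_C_ne_zero _ h2

/-! #### Galois structure of `L_f/K`: compatibility, commutativity, the subgroup `H = Gal(L_f/K(α))` -/

/-- `σ (ι x) = ι (σ|_L x)` for `σ ∈ Gal(L_f/K)`. [folklore] -/
theorem smul_inclSf [IsGalois K L] (σ : Ef ≃ₐ[K] Ef) (x : SL) :
    σ • inclSf K L t n x = inclSf K L t n (σ.restrictNormal L • x) :=
  Subtype.ext (by
    show σ (algebraMap L Ef x) = algebraMap L Ef (σ.restrictNormal L x)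
    exact (AlgEquiv.restrictNormal_commutes σ L x).symm)

/-- Every `σ ∈ Gal(L_f/K)` maps `α` to `α` or to `t - α`. [folklore] -/
theorem smul_root_eq_or (σ : Ef ≃ₐ[K] Ef) :
    σ (AdjoinRoot.root fKL) = AdjoinRoot.root fKL ∨
      σ (AdjoinRoot.root fKL) = algebraMap R Ef t - AdjoinRoot.root fKL := by
  have hsq := root_sq K L t n
  have ht : σ (algebraMap R Ef t) = algebraMap R Ef t := by
    rw [IsScalarTower.algebraMap_apply R K Ef, AlgEquiv.commutes]
  have hn : σ (algebraMap R Ef n) = algebraMap R Ef n := by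
    rw [IsScalarTower.algebraMap_apply R K Ef, AlgEquiv.commutes]
  have hsq' : σ (AdjoinRoot.root fKL) ^ 2 = algebraMap R Ef t * σ (AdjoinRoot.root fKL) - algebraMap R Ef n := by
    have := congrArg σ hsq
    rwa [map_pow, map_sub, map_mul, ht, hn] at this
  have h0 : (σ (AdjoinRoot.root fKL) - AdjoinRoot.root fKL) *
      (σ (AdjoinRoot.root fKL) - (algebraMap R Ef t - AdjoinRoot.root fKL)) = 0 := by
    linear_combination hsq' - hsq
  rcases mul_eq_zero.mp h0 with h | h
  · exact Or.inl (sub_eq_zero.mp h)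
  · exact Or.inr (sub_eq_zero.mp h)

/-- **`Gal(L_f/K)` is abelian** when `Gal(L/K)` is: two automorphisms commute on `L` and on
`α ↦ α, t - α`. [folklore] -/
theorem isMulCommutative_gal_adjoinRoot [IsGalois K L] [IsMulCommutative (L ≃ₐ[K] L)] :
    IsMulCommutative (Ef ≃ₐ[K] Ef) := by
  refine ⟨⟨fun σ τ => AlgEquiv.ext fun x => ?_⟩⟩
  obtain ⟨⟨a, b⟩, rfl⟩ := exists_coord K L t n x
  have hL : ∀ c : L, (σ * τ) (algebraMap L Ef c) = (τ * σ) (algebraMap L Ef c) := fun c => by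
    rw [AlgEquiv.mul_apply, AlgEquiv.mul_apply, ← AlgEquiv.restrictNormal_commutes τ L,
      ← AlgEquiv.restrictNormal_commutes σ L, ← AlgEquiv.restrictNormal_commutes σ L,
      ← AlgEquiv.restrictNormal_commutes τ L, ← AlgEquiv.mul_apply, ← AlgEquiv.mul_apply,
      IsMulCommutative.is_comm.comm (σ.restrictNormal L) (τ.restrictNormal L)]
  have ht : ∀ ρ : Ef ≃ₐ[K] Ef, ρ (algebraMap R Ef t) = algebraMap R Ef t := fun ρ => by
    rw [IsScalarTower.algebraMap_apply R K Ef, AlgEquiv.commutes]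
  have hα : (σ * τ) (AdjoinRoot.root fKL) = (τ * σ) (AdjoinRoot.root fKL) := by
    rw [AlgEquiv.mul_apply, AlgEquiv.mul_apply]
    rcases smul_root_eq_or K L t n σ with hσ | hσ <;> rcases smul_root_eq_or K L t n τ with hτ | hτ <;>
      simp only [hσ, hτ, map_sub, ht, sub_sub_cancel]
  simp only [map_add, map_mul, hL, hα]

variable [IsDedekindDomain R] [IsFractionRing R K] [FiniteDimensional K L] [IsGalois K L]

omit [IsDedekindDomain R] [FiniteDimensional K L] [IsGalois K L] [IsFractionRing R K] in
/-- `f_K` is monic of degree `2`. [folklore] -/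
theorem monic_map_quadPoly : ((quadPoly t n).map (algebraMap R K)).Monic ∧
    ((quadPoly t n).map (algebraMap R K)).natDegree = 2 := by
  haveI : Nontrivial R := (algebraMap R K).domain_nontrivial
  exact ⟨(monic_quadPoly t n).map _, by rw [(monic_quadPoly t n).natDegree_map, natDegree_quadPoly]⟩

omit [Algebra R L] [IsScalarTower R K L] [IsDedekindDomain R] [IsFractionRing R K] in
/-- `L_f/K` is Galois (for `f_K` separable). [folklore] -/
theorem isGalois_Ef (hsep : ((quadPoly t n).map (algebraMap R K)).Separable) : IsGalois K Ef :=
  isGalois_adjoinRoot_map K L _ (monic_map_quadPoly K t n).1 (monic_map_quadPoly K t n).2 hsep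

/-- `S_f` is a Dedekind domain. [folklore] -/
theorem isDedekindDomain_Sf (hsep : ((quadPoly t n).map (algebraMap R K)).Separable) :
    IsDedekindDomain Sf := by
  haveI : IsGalois K Ef := isGalois_Ef K L t n hsep
  haveI : FiniteDimensional K Ef := finiteDimensional_adjoinRoot_map K L _ (monic_map_quadPoly K t n).1
  exact integralClosure.isDedekindDomain R K Ef

set_option maxHeartbeats 800000 in
/-- **`ι⁻¹(𝔓_f^j) = 𝔓^j`** (`𝔓_f = 𝔓 S_f` is unramified over `𝔓`: `v_{𝔓_f} ∘ ι = v_𝔓`, by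
`ordIdeal_algebraMap` with `e = v_{𝔓_f}(𝔓 S_f) = 1`). [folklore] -/
theorem inclSf_mem_pow_iff (hsep : ((quadPoly t n).map (algebraMap R K)).Separable)
    (𝔓 : Ideal SL) [𝔓.IsMaximal] (h𝔓 : 𝔓 ≠ ⊥)
    (hnoroot : ∀ s : SL, s * s - algebraMap R SL t * s + algebraMap R SL n ∉ 𝔓)
    (hd : algebraMap R SL (t ^ 2 - 4 * n) ∉ 𝔓) (j : ℕ) (x : SL) :
    inclSf K L t n x ∈ 𝔓.map (inclSf K L t n) ^ j ↔ x ∈ 𝔓 ^ j := by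
  haveI : IsDedekindDomain SL := integralClosure.isDedekindDomain R K L
  haveI : IsDedekindDomain Sf := isDedekindDomain_Sf K L t n hsep
  obtain ⟨hmax, hcomap, -, -⟩ := map_inclSf_spec K L t n 𝔓 hnoroot hd
  haveI := hmax
  letI : Algebra SL Sf := (inclSf K L t n).toAlgebra
  have halg : algebraMap SL Sf = inclSf K L t n := rfl
  have hne : 𝔓.map (inclSf K L t n) ≠ ⊥ := by
    intro hbot
    obtain ⟨y, hy, hy0⟩ := Submodule.exists_mem_ne_zero_of_ne_bot h𝔓
    have : inclSf K L t n y = 0 := by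
      have h := Ideal.mem_map_of_mem (inclSf K L t n) hy
      rw [hbot] at h
      exact (Submodule.mem_bot _).mp h
    exact hy0 (inclSf_injective K L t n (by rw [this, map_zero]))
  have hord := ordIdeal_algebraMap (𝔓 := 𝔓.map (inclSf K L t n)) (𝔔 := 𝔓) hne h𝔓 (by rw [halg]) x
  have hmult : emultiplicity (𝔓.map (inclSf K L t n)) (𝔓.map (algebraMap SL Sf)) = 1 := by
    rw [halg]
    have h := emultiplicity_pow_self hne (fun hu => Ideal.IsPrime.ne_top
      (Ideal.IsMaximal.isPrime hmax) (Ideal.isUnit_iff.mp hu)) 1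
    rwa [pow_one, Nat.cast_one] at h
  rw [hmult, mul_one, halg] at hord
  rw [← le_ordIdeal_iff_mem_pow, ← le_ordIdeal_iff_mem_pow, hord]

set_option maxHeartbeats 1600000 in
/-- **Ramification of `𝔓_f` versus `𝔓`**: for `σ ∈ Gal(L_f/K)` fixing `α` whose restriction
`τ = σ|_L` lies in `G_i` (at `𝔓`), `σ` fixes `𝔓_f` and `σ y ≡ y (mod 𝔓_f^{i+1})` for all
`y ∈ S_f` (`d (σ y - y) = ι(τ a - a) + ι(τ b - b) α`, `d ∉ 𝔓_f`).  Ref: Serre, *Local Fields*,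
Ch. IV §1 Prop. 2 and Ch. V §4 Lemma 7 (unramified base change does not change the `G_i`).
[cite: SerreLocalFields1979, Ch. IV §1 Prop. 2] -/
theorem smul_map_inclSf_and_smul_sub_mem_pow (hsep : ((quadPoly t n).map (algebraMap R K)).Separable)
    (𝔓 : Ideal SL) [𝔓.IsMaximal] (h𝔓 : 𝔓 ≠ ⊥)
    (hnoroot : ∀ s : SL, s * s - algebraMap R SL t * s + algebraMap R SL n ∉ 𝔓)
    (hd : algebraMap R SL (t ^ 2 - 4 * n) ∉ 𝔓) (σ : Ef ≃ₐ[K] Ef)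
    (hσ : σ (AdjoinRoot.root fKL) = AdjoinRoot.root fKL) {i : ℕ}
    (hτ : σ.restrictNormal L ∈ 𝔓.ramificationSubgroup (L ≃ₐ[K] L) i) :
    σ • 𝔓.map (inclSf K L t n) = 𝔓.map (inclSf K L t n) ∧
      ∀ y : Sf, σ • y - y ∈ 𝔓.map (inclSf K L t n) ^ (i + 1) := by
  haveI : IsDedekindDomain SL := integralClosure.isDedekindDomain R K L
  haveI : IsDedekindDomain Sf := isDedekindDomain_Sf K L t n hsep
  obtain ⟨hmax, hcomap, -, -⟩ := map_inclSf_spec K L t n 𝔓 hnoroot hd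
  haveI := hmax
  haveI h𝔓fprime : (𝔓.map (inclSf K L t n)).IsPrime := Ideal.IsMaximal.isPrime hmax
  set ι := inclSf K L t n with hι
  set τ := σ.restrictNormal L with hτdef
  obtain ⟨hτstab, hτi⟩ := (Ideal.mem_ramificationSubgroup_iff).mp hτ
  -- `σ` fixes `𝔓_f`
  have hcomp : (MulSemiringAction.toRingHom (Ef ≃ₐ[K] Ef) Sf σ).comp ι =
      ι.comp (MulSemiringAction.toRingHom (L ≃ₐ[K] L) SL τ) := RingHom.ext fun x => by
    simp only [RingHom.coe_comp, Function.comp_apply, MulSemiringAction.toRingHom_apply]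
    exact smul_inclSf K L t n σ x
  have hstab : σ • 𝔓.map ι = 𝔓.map ι := by
    rw [Ideal.pointwise_smul_def, Ideal.map_map, hcomp, ← Ideal.map_map, ← Ideal.pointwise_smul_def, hτstab]
  refine ⟨hstab, fun y => ?_⟩
  have hne : 𝔓.map ι ≠ ⊥ := by
    intro hbot
    obtain ⟨z, hz, hz0⟩ := Submodule.exists_mem_ne_zero_of_ne_bot h𝔓
    have : ι z = 0 := by
      have h := Ideal.mem_map_of_mem ι hz
      rw [hbot] at h
      exact (Submodule.mem_bot _).mp h
    exact hz0 (inclSf_injective K L t n (by rw [← hι, this, map_zero]))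
  -- `d (σ y - y) = ι(τ a - a) + ι(τ b - b) α`
  set αS : Sf := ⟨AdjoinRoot.root fKL, root_mem_integralClosure_adjoinRoot K L t n⟩ with hαS
  have hσα : σ • αS = αS := Subtype.ext hσ
  have hdfix : σ • ι (algebraMap R SL (t ^ 2 - 4 * n)) = ι (algebraMap R SL (t ^ 2 - 4 * n)) := by
    rw [← algebraMap_Sf_eq_inclSf, smul_algebraMap]
  have key : ι (algebraMap R SL (t ^ 2 - 4 * n)) * (σ • y - y) =
      ι (τ • cA K L t n y - cA K L t n y) + ι (τ • cB K L t n y - cB K L t n y) * αS := by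
    have h := algebraMap_mul_eq_cA_cB K L t n y
    rw [algebraMap_Sf_eq_inclSf] at h
    have h2 : σ • (ι (algebraMap R SL (t ^ 2 - 4 * n)) * y) =
        σ • (ι (cA K L t n y) + ι (cB K L t n y) * αS) := congrArg (σ • ·) h
    rw [smul_mul', smul_add, smul_mul', hdfix, hσα, smul_inclSf, smul_inclSf, ← hτdef] at h2
    rw [mul_sub, h2, h, map_sub, map_sub]
    ring
  have hmem : ι (algebraMap R SL (t ^ 2 - 4 * n)) * (σ • y - y) ∈ 𝔓.map ι ^ (i + 1) := by
    rw [key, ← Ideal.map_pow]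
    exact Ideal.add_mem _ (Ideal.mem_map_of_mem ι (hτi _))
      (Ideal.mul_mem_right _ _ (Ideal.mem_map_of_mem ι (hτi _)))
  have hd0 : ordIdeal (𝔓.map ι) (ι (algebraMap R SL (t ^ 2 - 4 * n))) = (0 : ℕ) := by
    rw [Nat.cast_zero, ordIdeal_eq_zero_iff]
    intro h
    exact hd (by rw [← hcomap, Ideal.mem_comap]; exact h)
  exact mem_pow_of_mul_mem_pow_add _ hne hd0 (by rw [zero_add]; exact hmem)

set_option maxHeartbeats 1600000 in
/-- **`|H_i| = |G_i|`**: restriction to `L` is a bijection from the `i`-th ramification group of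
`H = Gal(L_f/K(α))` at `𝔓_f` onto `G_i` (at `𝔓`), when `𝔓` is totally ramified in `L/K`.
Ref: Serre, *Local Fields*, Ch. V §4 Lemma 7. [cite: SerreLocalFields1979, Ch. V §4 Lemma 7] -/
theorem card_ramificationSubgroup_fixingSubgroup_eq
    (hsep : ((quadPoly t n).map (algebraMap R K)).Separable)
    (𝔓 : Ideal SL) [𝔓.IsMaximal] (h𝔓 : 𝔓 ≠ ⊥)
    (hnoroot : ∀ s : SL, s * s - algebraMap R SL t * s + algebraMap R SL n ∉ 𝔓)
    (hd : algebraMap R SL (t ^ 2 - 4 * n) ∉ 𝔓) (htot : 𝔓.inertia (L ≃ₐ[K] L) = ⊤) (i : ℕ) :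
    Nat.card ((𝔓.map (inclSf K L t n)).ramificationSubgroup
        (IntermediateField.fixingSubgroup Kf) i) =
      Nat.card (𝔓.ramificationSubgroup (L ≃ₐ[K] L) i) := by
  classical
  haveI : IsGalois K Ef := isGalois_Ef K L t n hsep
  haveI : FiniteDimensional K Ef := finiteDimensional_adjoinRoot_map K L _ (monic_map_quadPoly K t n).1
  set ι := inclSf K L t n with hι
  set H : Subgroup (Ef ≃ₐ[K] Ef) := IntermediateField.fixingSubgroup Kf with hH
  have hHα : ∀ σ : H, (σ : Ef ≃ₐ[K] Ef) (AdjoinRoot.root fKL) = AdjoinRoot.root fKL := fun σ =>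
    (IntermediateField.mem_fixingSubgroup_iff _ _).mp σ.2 _ (IntermediateField.mem_adjoin_simple_self K _)
  -- restriction `H → G` is a bijection
  set ρ : H → (L ≃ₐ[K] L) := fun σ => (σ : Ef ≃ₐ[K] Ef).restrictNormal L with hρ
  have hρinj : Function.Injective ρ := by
    intro σ₁ σ₂ h
    apply Subtype.ext
    apply AlgEquiv.ext
    intro x
    obtain ⟨⟨a, b⟩, rfl⟩ := exists_coord K L t n x
    have hL : ∀ c : L, (σ₁ : Ef ≃ₐ[K] Ef) (algebraMap L Ef c) = (σ₂ : Ef ≃ₐ[K] Ef) (algebraMap L Ef c) :=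
      fun c => by
        rw [← AlgEquiv.restrictNormal_commutes, ← AlgEquiv.restrictNormal_commutes]
        exact congrArg (algebraMap L Ef) (congrArg (fun g : L ≃ₐ[K] L => g c) h)
    simp only [map_add, map_mul, hL, hHα]
  have hρbij : Function.Bijective ρ := by
    refine (Nat.bijective_iff_injective_and_card ρ).mpr ⟨hρinj, ?_⟩
    rw [hH, IsGalois.card_fixingSubgroup_eq_finrank, IsGalois.card_aut_eq_finrank]
    exact finrank_adjoinRoot_eq K L _ (monic_map_quadPoly K t n).1 (monic_map_quadPoly K t n).2
  -- it maps `H_i` onto `G_i`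
  have hmemG : ∀ σ : H, (σ : H) ∈ (𝔓.map ι).ramificationSubgroup H i → ρ σ ∈ 𝔓.ramificationSubgroup (L ≃ₐ[K] L) i := by
    intro σ hσ
    obtain ⟨-, hσi⟩ := (Ideal.mem_ramificationSubgroup_iff).mp
      ((mem_ramificationSubgroup_subgroup_iff (𝔓.map ι) H).mp hσ)
    refine (Ideal.mem_ramificationSubgroup_iff).mpr ⟨Ideal.inertia_le_stabilizer 𝔓 (htot ▸ Subgroup.mem_top _), fun x => ?_⟩
    rw [← inclSf_mem_pow_iff K L t n hsep 𝔓 h𝔓 hnoroot hd, map_sub, ← smul_inclSf]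
    exact hσi (ι x)
  have hmemH : ∀ σ : H, ρ σ ∈ 𝔓.ramificationSubgroup (L ≃ₐ[K] L) i → (σ : H) ∈ (𝔓.map ι).ramificationSubgroup H i := by
    intro σ hτ
    obtain ⟨h1, h2⟩ := smul_map_inclSf_and_smul_sub_mem_pow K L t n hsep 𝔓 h𝔓 hnoroot hd σ (hHα σ) hτ
    exact (mem_ramificationSubgroup_subgroup_iff (𝔓.map ι) H).mpr
      ((Ideal.mem_ramificationSubgroup_iff).mpr ⟨h1, h2⟩)
  refine Nat.card_congr (Equiv.ofBijective
    (fun σ : (𝔓.map ι).ramificationSubgroup H i => (⟨ρ σ, hmemG σ σ.2⟩ : 𝔓.ramificationSubgroup (L ≃ₐ[K] L) i))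
    ⟨fun σ₁ σ₂ h => Subtype.ext (hρinj (congrArg Subtype.val h)), fun τ => ?_⟩)
  obtain ⟨σ, hσ⟩ := hρbij.2 τ
  exact ⟨⟨σ, hmemH σ (hσ ▸ τ.2)⟩, Subtype.ext hσ⟩

set_option maxHeartbeats 3200000 in
set_option synthInstance.maxHeartbeats 400000 in
/-- **Prop. V.11 for `(L, 𝔓)` from Prop. V.11 for the unramified quadratic base change
`(L_f, 𝔓_f)`.**  Let `L/K` be cyclic, totally ramified at the maximal ideal `𝔓 ≠ 0` of `S_L`
with finite residue field, and `f = X² - tX + n ∈ R[X]` with `f_K` separable, without roots modulo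
`𝔓` and with `t² - 4n ∉ 𝔓`.  If `μ` is the last jump of `G = Gal(L/K)` at `𝔓` then
`|G| ∣ Σ_{i=1}^{μ} |G_i|`.  Proof: `L_f/K` is abelian (`isMulCommutative_gal_adjoinRoot`),
`H = Gal(L_f/K(α))` is cyclic and contained in the inertia group of the maximal ideal
`𝔓_f = 𝔓 S_f` (`map_inclSf_spec`, `smul_map_inclSf_and_smul_sub_mem_pow`), whose residue field
contains the class of `α`, not the class of a natural number; `|H_i| = |G_i|`
(`card_ramificationSubgroup_fixingSubgroup_eq`); apply
`card_dvd_ramificationCardSum_of_exists_sub_natCast_notMem` to `(R, K, L_f, 𝔓_f, H)`.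
Ref: Serre, *Local Fields*, Ch. V §4 Lemma 7 and §7 Prop. 11 (p. 94, "the residue field is not
the prime field"). [cite: SerreLocalFields1979, Ch. V §7 Prop. 11] -/
theorem card_dvd_sum_card_ramificationSubgroup_of_quadPoly [IsCyclic (L ≃ₐ[K] L)]
    (hsep : ((quadPoly t n).map (algebraMap R K)).Separable)
    (𝔓 : Ideal SL) [𝔓.IsMaximal] (h𝔓 : 𝔓 ≠ ⊥)
    (hnoroot : ∀ s : SL, s * s - algebraMap R SL t * s + algebraMap R SL n ∉ 𝔓)
    (hd : algebraMap R SL (t ^ 2 - 4 * n) ∉ 𝔓) (htot : 𝔓.inertia (L ≃ₐ[K] L) = ⊤)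
    (hfin : Finite (SL ⧸ 𝔓)) {μ : ℕ} (hμ : 𝔓.ramificationSubgroup (L ≃ₐ[K] L) μ ≠ ⊥)
    (hμ1 : 𝔓.ramificationSubgroup (L ≃ₐ[K] L) (μ + 1) = ⊥) :
    Nat.card (L ≃ₐ[K] L) ∣ ∑ i ∈ Finset.Icc 1 μ, Nat.card (𝔓.ramificationSubgroup (L ≃ₐ[K] L) i) := by
  classical
  have hm := monic_map_quadPoly K t n
  haveI : IsGalois K Ef := isGalois_Ef K L t n hsep
  haveI : FiniteDimensional K Ef := finiteDimensional_adjoinRoot_map K L _ hm.1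
  haveI : IsMulCommutative (L ≃ₐ[K] L) := IsCyclic.isMulCommutative
  haveI : IsMulCommutative (Ef ≃ₐ[K] Ef) := isMulCommutative_gal_adjoinRoot K L t n
  haveI : IsDedekindDomain SL := integralClosure.isDedekindDomain R K L
  haveI : IsDedekindDomain Sf := isDedekindDomain_Sf K L t n hsep
  obtain ⟨hmax, hcomap, hfinq, hbigα⟩ := map_inclSf_spec K L t n 𝔓 hnoroot hd
  haveI := hmax
  set ι := inclSf K L t n with hι
  set H : Subgroup (Ef ≃ₐ[K] Ef) := IntermediateField.fixingSubgroup Kf with hH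
  haveI : IsCyclic (Ef ≃ₐ[↥Kf] Ef) := isCyclic_of_restrictQuadratic K L _ hm.1 hm.2 hsep
  haveI : IsCyclic H := isCyclic_of_surjective (IntermediateField.fixingSubgroupEquiv Kf).symm
    (MulEquiv.surjective _)
  have hcard : ∀ i, Nat.card ((𝔓.map ι).ramificationSubgroup H i) =
      Nat.card (𝔓.ramificationSubgroup (L ≃ₐ[K] L) i) := fun i =>
    card_ramificationSubgroup_fixingSubgroup_eq K L t n hsep 𝔓 h𝔓 hnoroot hd htot i
  have hHα : ∀ σ ∈ H, σ (AdjoinRoot.root fKL) = AdjoinRoot.root fKL := fun σ hσ =>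
    (IntermediateField.mem_fixingSubgroup_iff _ _).mp hσ _ (IntermediateField.mem_adjoin_simple_self K _)
  -- `H ≤ T_{𝔓_f}`
  have hHin : H ≤ (𝔓.map ι).inertia (Ef ≃ₐ[K] Ef) := by
    intro σ hσ
    have h0 : σ.restrictNormal L ∈ 𝔓.ramificationSubgroup (L ≃ₐ[K] L) 0 := by
      rw [Ideal.ramificationSubgroup_zero, htot]; exact Subgroup.mem_top _
    obtain ⟨-, h2⟩ := smul_map_inclSf_and_smul_sub_mem_pow K L t n hsep 𝔓 h𝔓 hnoroot hd σ (hHα σ hσ) h0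
    refine (AddSubgroup.mem_inertia (I := (𝔓.map ι).toAddSubgroup)).mpr fun y => ?_
    have := h2 y
    rwa [zero_add, pow_one] at this
  -- `𝔓_f ≠ 0`, finite separable residue extension
  have hne : 𝔓.map ι ≠ ⊥ := by
    intro hbot
    obtain ⟨z, hz, hz0⟩ := Submodule.exists_mem_ne_zero_of_ne_bot h𝔓
    have : ι z = 0 := by
      have h := Ideal.mem_map_of_mem ι hz
      rw [hbot] at h
      exact (Submodule.mem_bot _).mp h
    exact hz0 (inclSf_injective K L t n (by rw [← hι, this, map_zero]))
  haveI hsepf : Algebra.IsSeparable (R ⧸ (𝔓.map ι).under R) (Sf ⧸ 𝔓.map ι) := by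
    haveI : ((𝔓.map ι).under R).IsMaximal := Ideal.IsMaximal.under R (𝔓.map ι)
    letI : Field (Sf ⧸ 𝔓.map ι) := Ideal.Quotient.field _
    letI : Field (R ⧸ (𝔓.map ι).under R) := Ideal.Quotient.field _
    haveI : Finite (Sf ⧸ 𝔓.map ι) := hfinq hfin
    haveI : Finite (R ⧸ (𝔓.map ι).under R) :=
      Finite.of_injective _ (Ideal.algebraMap_quotient_injective (R := R) (I := 𝔓.map ι))
    haveI : PerfectField (R ⧸ (𝔓.map ι).under R) := PerfectField.ofFinite
    haveI : Algebra.IsAlgebraic (R ⧸ (𝔓.map ι).under R) (Sf ⧸ 𝔓.map ι) :=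
      Algebra.IsAlgebraic.of_finite _ _
    exact Algebra.IsAlgebraic.isSeparable_of_perfectField
  -- the last jump of `H` is `μ`
  have hμH : (𝔓.map ι).ramificationSubgroup H μ ≠ ⊥ := fun h => hμ (by
    rw [← Subgroup.card_eq_one, ← hcard μ, h, Subgroup.card_bot])
  have hμH1 : (𝔓.map ι).ramificationSubgroup H (μ + 1) = ⊥ :=
    Subgroup.card_eq_one.mp (by rw [hcard, hμ1, Subgroup.card_bot])
  -- Prop. 11 for `(L_f, 𝔓_f, H)`
  have hcore := card_dvd_ramificationCardSum_of_exists_sub_natCast_notMem (𝔓.map ι) hne H hHin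
    ⟨⟨AdjoinRoot.root fKL, root_mem_integralClosure_adjoinRoot K L t n⟩, hbigα⟩ hμH hμH1
  rw [ramificationCardSum] at hcore
  simp only [hcard] at hcore
  have hcardH : Nat.card H = Nat.card (L ≃ₐ[K] L) := by
    rw [hH, IsGalois.card_fixingSubgroup_eq_finrank, IsGalois.card_aut_eq_finrank]
    exact finrank_adjoinRoot_eq K L _ hm.1 hm.2
  rwa [hcardH] at hcore

end ResidueExt


end Literature.NumberTheory.GaloisRepresentations

end
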